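import Literature.AnabelianGeometry.AbsoluteAnabelian.AbsTopIII.BiAnabelianCompatibilityShift
import Literature.AnabelianGeometry.AbsoluteAnabelian.AbsTopIII.BiAnabelianCompatibilityTelecore
import Literature.AnabelianGeometry.AbsoluteAnabelian.AbsTopIII.BiAnabelianDeltaFamilyProofs

/-!
# [AbsTopIII] Cor. 3.7 (v), final sentence — a family realising the telecore `𝔗_δ` AND `ℋ_δ`

[cite: MochizukiAbsTopIII2015, Cor 3.7 (ii) pp.87–88] [cite: MochizukiAbsTopIII2015, Cor 3.7 (v) p.88]

abc-iut-L4-t5 (gen 6), successor statement `ShiftCompatStmt′ θ` (`BiAnabelianCompatibilityShift.lean`), second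
conjunct: the family `K'` of `RealisesTeleDelta θ K'` — ONE family on `𝒟*` containing the telecore family `𝒥` of
`𝔗_δ` (along `𝒟‡_δ ↪ 𝒟*`) and the family `ℋ_δ` with the printed generators `θ_{□⋎}`, `θ_⋎` ("[`ℋ_δ` gives] by
restriction, a contact structure on the telecore `𝔗_δ`").  We take `K'` := THE CANONICAL FAMILY of abc-iut-L4-t12's
pseudo-commuting shadow of `𝒟*` determined by `θ^bi` (`BiAnabelianDeltaFamilyProofs`: shadows `𝒳` over rows ≤ 2 and
the core vertex via `π_𝒳`, fully faithful; `deltaShadow θ`, `(deltaShadow θ).shadowFamily (deltaFF θ)`: boundary set =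
ALL pairs with equal shadows, universal homotopies), of which t12's `ℋ_δ = deltaFamily θ` is by construction the
restriction to the saturation of the printed generators.  PROVED for every setting and every `θ^bi`:

* `deltaFamily_le_shadowFamily` / `deltaFamily_compatibleAlong_id_shadowFamily` — `ℋ_δ ⊆ K'` (same homotopies);
* `shP_embTele_heq_id`, `canH_embTele_eq_eqToHom` — along the image of `𝒟‡_δ` every shadow functor is the identity
  of `𝒳` and every coherence 2-cell `can` is an identity (the edges `log_𝒳`, `π_⋎`, `δ_⋎` carry identity 2-cells;
  `θ^bi` sits over `pr_⋎` only), hence `teleJfam_compatibleAlong_shadowFamily` — `𝒥 ⊆ K'` along `embTele` (both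
  carry identity homotopies on the core-suffix pairs);
* `realisesTeleDelta_shadowFamily θ : 𝔖.RealisesTeleDelta θ K'` and `exists_realisesTeleDelta`.

What remains of the second conjunct of `ShiftCompatStmt′ θ` is the invariance of `K'` under the `ℤ`-translations
`Φ_m` (the shadow data are literally translation-invariant; bookkeeping on the pattern of abc-iut-w6-d023's
`DiagramShiftInvarianceLifts` for universal families over a category).  Proof-only; model-level bookkeeping;
nothing here bears on [IUTchIII] Cor. 3.12.
-/

set_option autoImplicit false

namespace Literature.AnabelianGeometry.AbsoluteAnabelian

open _root_.CategoryTheory _root_.Quiver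

universe u

namespace AbsTopIII

open DiagramOfCategories

/-- `eqToHom`s between pairwise equal objects are heterogeneously equal. [folklore] -/
private theorem eqToHom_heq_eqToHom' {C : Type*} [Category C] {A B A' B' : C} (hA : A = A')
    (hB : B = B') (h : A = B) (h' : A' = B') : HEq (eqToHom h) (eqToHom h') := by
  subst hA; subst hB; rfl

namespace BiAnabelianSetting

variable {X E N : Type u} [Category.{u} X] [Category.{u} E] [Category.{u} N]
  (𝔖 : BiAnabelianSetting X E N) (θ : FiberSquare.BiAnabelianLift 𝔖.gal)

/-! ## `ℋ_δ` is a restriction of the canonical shadow family `K'` -/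

/-- `ℋ_δ ⊆ K'`: every boundary pair of `ℋ_δ` is a boundary pair of the canonical family of the shadow, with the
same homotopy (t12's `ℋ_δ` IS the restriction of the canonical family to the saturation of `DeltaGen`).
[cite: MochizukiAbsTopIII2015, Cor 3.7 (ii) p.88] -/
theorem deltaFamily_le_shadowFamily {a b : Cor37Vertex} {P Q : Path a b} (h : (𝔖.deltaFamily θ).E P Q) :
    ∃ h' : ((𝔖.deltaShadow θ).shadowFamily (𝔖.deltaFF θ)).E P Q,
      (𝔖.deltaFamily θ).η h = ((𝔖.deltaShadow θ).shadowFamily (𝔖.deltaFF θ)).η h' :=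
  ⟨(𝔖.deltaShadow θ).shP_eq_of_saturation DeltaGen.{u} (fun _ _ _ _ h => 𝔖.deltaGen_shP θ h) h, rfl⟩

/-- Hence `ℋ_δ` is contained in `K'` along the identity of `Γ⃗_{𝒟*}` (Def. 3.5 (ii) compatibility).
[cite: MochizukiAbsTopIII2015, Cor 3.7 (ii) p.88] -/
theorem deltaFamily_compatibleAlong_id_shadowFamily :
    (𝔖.deltaFamily θ).CompatibleAlong (𝟭q Cor37Vertex) ((𝔖.deltaShadow θ).shadowFamily (𝔖.deltaFF θ)) := by
  intro a b P Q h
  rw [Prefunctor.mapPath_id, Prefunctor.mapPath_id]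
  obtain ⟨h', hη⟩ := 𝔖.deltaFamily_le_shadowFamily θ h
  exact ⟨h', heq_of_eq hη⟩

/-! ## Along `𝒟‡_δ ↪ 𝒟*` the shadow is strictly trivial -/

/-- **Every shadow functor along the image of a path of `𝒟‡_δ` is the identity of `𝒳`** (the edges `log_𝒳`, `π_⋎`,
`δ_⋎` have shadow `𝟭_𝒳`). [cite: MochizukiAbsTopIII2015, Cor 3.7 (ii) p.87] -/
theorem shP_embTele_heq_id {a b : 𝔖.teleShape.Vertex} (p : Path a b) :
    HEq ((𝔖.deltaShadow θ).shP ((embTele (𝔖.teleT θ)).mapPath p)) (𝟭 (Cat.of X) : Cat.of X ⥤ Cat.of X) := by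
  induction p with
  | nil =>
    rcases a with ⟨_ | _ | _ | _ | _, ha⟩ | _
    · exact HEq.rfl
    · exact absurd ha.2 (by decide)
    · exact absurd ha.2 (by decide)
    · exact absurd ha.2 (by decide)
    · exact absurd rfl ha.1
    · exact HEq.rfl
  | cons p e ih =>
    rename_i b' c
    change HEq ((𝔖.deltaShadow θ).shP ((embTele (𝔖.teleT θ)).mapPath p) ⋙
      𝔖.deltaShe ((embTele (𝔖.teleT θ)).map e)) _
    revert e
    rcases b' with ⟨_ | _ | _ | _ | _, hb⟩ | _ <;> rcases c with ⟨_ | _ | _ | _ | _, hc⟩ | _ <;> intro e <;>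
      first
        | exact (PEmpty.elim e)
        | exact absurd hb.2 (by decide)
        | exact absurd rfl hb.1
        | exact absurd hc.2 (by decide)
        | exact absurd rfl hc.1
        | (cases e; exact (heq_of_eq (Functor.comp_id _)).trans ih)

/-- Hence two co-verticial paths of `𝒟‡_δ` have EQUAL shadows in `𝒟*`. [cite: MochizukiAbsTopIII2015, Cor 3.7 (ii) p.87] -/
theorem shP_embTele_eq {a b : 𝔖.teleShape.Vertex} (p q : Path a b) :
    (𝔖.deltaShadow θ).shP ((embTele (𝔖.teleT θ)).mapPath p) =
      (𝔖.deltaShadow θ).shP ((embTele (𝔖.teleT θ)).mapPath q) :=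
  eq_of_heq ((𝔖.shP_embTele_heq_id θ p).trans (𝔖.shP_embTele_heq_id θ q).symm)

/-- The objects related by the coherence 2-cell `can` along the image of a path of `𝒟‡_δ` coincide.
[cite: MochizukiAbsTopIII2015, Cor 3.7 (ii) p.87] -/
theorem canH_embTele_obj_eq {a b : 𝔖.teleShape.Vertex} (p : Path a b)
    (x : 𝔖.starDiagram.obj ((embTele (𝔖.teleT θ)).obj a)) :
    ((𝔖.deltaShadow θ).aug ((embTele (𝔖.teleT θ)).obj b)).obj
        ((𝔖.starDiagram.pathFunctor' ((embTele (𝔖.teleT θ)).mapPath p)).obj x) =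
      ((𝔖.deltaShadow θ).shP ((embTele (𝔖.teleT θ)).mapPath p)).obj
        (((𝔖.deltaShadow θ).aug ((embTele (𝔖.teleT θ)).obj a)).obj x) := by
  induction p with
  | nil => rfl
  | cons p e ih =>
    rename_i b' c
    change ((𝔖.deltaShadow θ).aug _).obj ((𝔖.starDiagram.map ((embTele (𝔖.teleT θ)).map e)).obj
      ((𝔖.starDiagram.pathFunctor' ((embTele (𝔖.teleT θ)).mapPath p)).obj x)) =
      (𝔖.deltaShe ((embTele (𝔖.teleT θ)).map e)).obj _
    revert e
    rcases b' with ⟨_ | _ | _ | _ | _, hb⟩ | _ <;> rcases c with ⟨_ | _ | _ | _ | _, hc⟩ | _ <;> intro e <;>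
      first
        | exact (PEmpty.elim e)
        | exact absurd hb.2 (by decide)
        | exact absurd rfl hb.1
        | exact absurd hc.2 (by decide)
        | exact absurd rfl hc.1
        | (cases e; exact ih)

/-- **Every coherence 2-cell `can_[γ]` along the image of a path of `𝒟‡_δ` is an identity** (`eqToHom`): the edges
`log_𝒳`, `π_⋎`, `δ_⋎` carry identity 2-cells (`θ^bi` sits over `pr_⋎` only). [cite: MochizukiAbsTopIII2015, Cor 3.7 (ii) p.87] -/
theorem canH_embTele_eq_eqToHom {a b : 𝔖.teleShape.Vertex} (p : Path a b)
    (x : 𝔖.starDiagram.obj ((embTele (𝔖.teleT θ)).obj a)) :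
    (𝔖.deltaShadow θ).canH ((embTele (𝔖.teleT θ)).mapPath p) x = eqToHom (𝔖.canH_embTele_obj_eq θ p x) := by
  induction p with
  | nil => rfl
  | cons p e ih =>
    rename_i b' c
    change (𝔖.deltaShadow θ).canE ((embTele (𝔖.teleT θ)).map e) _ ≫
      ((𝔖.deltaShadow θ).she ((embTele (𝔖.teleT θ)).map e)).map
        ((𝔖.deltaShadow θ).canH ((embTele (𝔖.teleT θ)).mapPath p) x) = _
    rw [ih]
    revert e
    rcases b' with ⟨_ | _ | _ | _ | _, hb⟩ | _ <;> rcases c with ⟨_ | _ | _ | _ | _, hc⟩ | _ <;> intro e <;>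
      first
        | exact (PEmpty.elim e)
        | exact absurd hb.2 (by decide)
        | exact absurd rfl hb.1
        | exact absurd hc.2 (by decide)
        | exact absurd rfl hc.1
        | (cases e; exact Category.id_comp _)

/-! ## `𝒥 ⊆ K'` along `𝒟‡_δ ↪ 𝒟*` -/

/-- The inverse coherence 2-cell along the image of a path of `𝒟‡_δ` is the inverse identity.
[cite: MochizukiAbsTopIII2015, Cor 3.7 (ii) p.87] -/
theorem canI_embTele_eq_eqToHom {a b : 𝔖.teleShape.Vertex} (p : Path a b)
    (x : 𝔖.starDiagram.obj ((embTele (𝔖.teleT θ)).obj a)) :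
    (𝔖.deltaShadow θ).canI ((embTele (𝔖.teleT θ)).mapPath p) x = eqToHom (𝔖.canH_embTele_obj_eq θ p x).symm := by
  have h1 := (𝔖.deltaShadow θ).canH_canI ((embTele (𝔖.teleT θ)).mapPath p) x
  rw [canH_embTele_eq_eqToHom, eqToHom_comp_iff, Category.comp_id] at h1
  exact h1

/-- The structural path functors of `𝒟*` along the images of two co-verticial paths of `𝒟‡_δ` into the core vertex
coincide, and so do those of a core-suffix pair. [cite: MochizukiAbsTopIII2015, Cor 3.7 (ii) p.87] -/
theorem pathFunctor'_embTele_eq_of_comp {a b : 𝔖.teleShape.Vertex} (p₁ q₁ : Path a 𝔖.teleShape.obs)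
    (r : Path 𝔖.teleShape.obs b) :
    𝔖.starDiagram.pathFunctor' ((embTele (𝔖.teleT θ)).mapPath (p₁.comp r)) =
      𝔖.starDiagram.pathFunctor' ((embTele (𝔖.teleT θ)).mapPath (q₁.comp r)) := by
  rw [← 𝔖.starDiagram.pathFunctor_eq_pathFunctor', ← 𝔖.starDiagram.pathFunctor_eq_pathFunctor']
  exact eq_of_heq (((𝔖.teleDiag_pathFunctor_heq θ (p₁.comp r)).symm.trans
    (heq_of_eq (𝔖.telePathFunctor_eq_of_comp p₁ q₁ r))).trans (𝔖.teleDiag_pathFunctor_heq θ (q₁.comp r)))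

/-- **On the image of a core-suffix pair the canonical family's universal homotopy is the identity** (uniqueness:
the identity lies over `can ≫ can⁻¹`, both `can`'s being identities). [cite: MochizukiAbsTopIII2015, Cor 3.7 (ii) p.87] -/
theorem shadow_univ_embTele_eq_eqToHom {a b : 𝔖.teleShape.Vertex} (p₁ q₁ : Path a 𝔖.teleShape.obs)
    (r : Path 𝔖.teleShape.obs b)
    (h : (𝔖.deltaShadow θ).shP ((embTele (𝔖.teleT θ)).mapPath (p₁.comp r)) =
      (𝔖.deltaShadow θ).shP ((embTele (𝔖.teleT θ)).mapPath (q₁.comp r))) :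
    (𝔖.deltaShadow θ).univ (𝔖.deltaFF θ _) _ _ h = eqToHom (𝔖.pathFunctor'_embTele_eq_of_comp θ p₁ q₁ r) := by
  refine ((𝔖.deltaShadow θ).univ_eq (𝔖.deltaFF θ _) h _ fun x => ?_).symm
  rw [eqToHom_app, eqToHom_map, canH_embTele_eq_eqToHom, canI_embTele_eq_eqToHom, eqToHom_trans, eqToHom_trans]

/-- The homotopy of `K'` on the image of a core-suffix pair is the identity `eqToHom`.
[cite: MochizukiAbsTopIII2015, Cor 3.7 (ii) p.87] -/
theorem shadowFamily_η_embTele_eq_eqToHom {a b : 𝔖.teleShape.Vertex} (p₁ q₁ : Path a 𝔖.teleShape.obs)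
    (r : Path 𝔖.teleShape.obs b)
    (h : ((𝔖.deltaShadow θ).shadowFamily (𝔖.deltaFF θ)).E ((embTele (𝔖.teleT θ)).mapPath (p₁.comp r))
      ((embTele (𝔖.teleT θ)).mapPath (q₁.comp r)))
    (e : 𝔖.starDiagram.pathFunctor ((embTele (𝔖.teleT θ)).mapPath (p₁.comp r)) =
      𝔖.starDiagram.pathFunctor ((embTele (𝔖.teleT θ)).mapPath (q₁.comp r))) :
    ((𝔖.deltaShadow θ).shadowFamily (𝔖.deltaFF θ)).η h = eqToHom e := by
  change eqToHom _ ≫ (𝔖.deltaShadow θ).univ (𝔖.deltaFF θ _) _ _ h ≫ eqToHom _ = _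
  rw [𝔖.shadow_univ_embTele_eq_eqToHom θ p₁ q₁ r h, eqToHom_trans, eqToHom_trans]

/-- **The telecore family `𝒥` of `𝔗_δ` is contained in `K'` along `𝒟‡_δ ↪ 𝒟*`**: a core-suffix pair has equal
(trivial) shadows, and both families carry the identity homotopy on it. [cite: MochizukiAbsTopIII2015, Cor 3.7 (v) p.88] -/
theorem teleJfam_compatibleAlong_shadowFamily :
    (𝔖.teleT θ).Jfam.CompatibleAlong (embTele (𝔖.teleT θ)) ((𝔖.deltaShadow θ).shadowFamily (𝔖.deltaFF θ)) := by
  intro a b p q h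
  obtain ⟨p₁, q₁, r, rfl, rfl⟩ := h
  have h' : ((𝔖.deltaShadow θ).shadowFamily (𝔖.deltaFF θ)).E ((embTele (𝔖.teleT θ)).mapPath (p₁.comp r))
      ((embTele (𝔖.teleT θ)).mapPath (q₁.comp r)) := 𝔖.shP_embTele_eq θ _ _
  refine ⟨h', ?_⟩
  have hP := 𝔖.teleDiag_pathFunctor_heq θ (p₁.comp r)
  have hQ := 𝔖.teleDiag_pathFunctor_heq θ (q₁.comp r)
  have e : 𝔖.starDiagram.pathFunctor ((embTele (𝔖.teleT θ)).mapPath (p₁.comp r)) =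
      𝔖.starDiagram.pathFunctor ((embTele (𝔖.teleT θ)).mapPath (q₁.comp r)) :=
    eq_of_heq ((hP.symm.trans (heq_of_eq (𝔖.telePathFunctor_eq_of_comp p₁ q₁ r))).trans hQ)
  change HEq (𝔖.teleη θ (p₁.comp r) (q₁.comp r)) _
  rw [𝔖.teleη_eq_eqToHom θ _ _ (𝔖.telePathFunctor_eq_of_comp p₁ q₁ r),
    𝔖.shadowFamily_η_embTele_eq_eqToHom θ p₁ q₁ r h' e]
  revert e hP hQ
  generalize 𝔖.telePathFunctor_eq_of_comp p₁ q₁ r = e'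
  revert e'
  generalize 𝔖.teleDiag.pathFunctor (p₁.comp r) = P₁
  generalize 𝔖.teleDiag.pathFunctor (q₁.comp r) = Q₁
  rcases a with _ | _ <;> rcases b with _ | _ <;>
  · intro e' hP hQ e
    exact eqToHom_heq_eqToHom' (eq_of_heq hP) (eq_of_heq hQ) _ _

/-! ## `K'` realises `𝔗_δ` and `ℋ_δ` -/

/-- **The canonical family of the shadow realises the telecore `𝔗_δ` AND `ℋ_δ`** (the second family of the
successor statement `ShiftCompatStmt′ θ`), for every setting and every `θ^bi`. [cite: MochizukiAbsTopIII2015, Cor 3.7 (v) p.88] -/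
theorem realisesTeleDelta_shadowFamily :
    𝔖.RealisesTeleDelta θ ((𝔖.deltaShadow θ).shadowFamily (𝔖.deltaFF θ)) :=
  ⟨⟨𝔖.refCoreFamily, 𝔖.refCoreFamily_terminal, 𝔖.refCoreObs_isCore, 𝔖.teleT θ, 𝔖.teleT_isTelecoreDelta θ,
      𝔖.teleJfam_compatibleAlong_shadowFamily θ⟩,
    ⟨𝔖.deltaFamily θ, 𝔖.deltaFamily_isGeneratedBy θ, 𝔖.deltaFamily_pinned θ,
      𝔖.deltaFamily_compatibleAlong_id_shadowFamily θ⟩⟩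

/-- Hence such a family exists (every setting, every `θ^bi`). [cite: MochizukiAbsTopIII2015, Cor 3.7 (v) p.88] -/
theorem exists_realisesTeleDelta : ∃ K' : 𝔖.starDiagram.HomotopyFamily, 𝔖.RealisesTeleDelta θ K' :=
  ⟨_, 𝔖.realisesTeleDelta_shadowFamily θ⟩

end BiAnabelianSetting

end AbsTopIII

end Literature.AnabelianGeometry.AbsoluteAnabelian
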